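import Summits.Ventures.FusionMHD.Bench.SolovevPCFNstxMercierEdgeGGJ
import Summits.Ventures.FusionMHD.Bench.SolovevPCFIterMercierEdgeSubst
import Summits.Ventures.FusionMHD.Models.SolovevPCFSafetyFactorProfile
import Literature.MathematicalPhysics.MHD.SolovevFluxSurfaceForceBalance
import HarnessLib

/-!
# F1 / MERCIER at the NSTX-like PCF edge — KERNEL BRIDGE 1/3: the printed edge loop in the substituted variable and the
# `t`-integrals `∫w`, `∫∂w/∂r`, `∫(u√u)⁻¹`, `∫lcQKernelDr` as rational multiples of the certified `K₁, K₂, K₄ = edgeI, K₃`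
(venture LADDER-GRIDFUSION, rung F1.MERCIER-profile; cell `gridfusion`, seat `gridfusion-sos-6` (g3), 2026-08-27. NSTX-like twin
of `…SolovevPCFIterMercierEdge{Subst,Integrals1}`; the instance-independent half-angle substitution `θ(w) = 2·arcsin(√2·w/2)`
and its two integral identities are REUSED from the ITER-like file via `open … (theta …)`.)

PURPOSE OF THE THREE `…NstxMercierEdge{Integrals1,Integrals2,Kernel}` FILES: as for the ITER-like series — prove in the kernel
that gridfusion-model-5's GGJ input record (`Solovev.lcGGJData`, p481986: the thirteen Jardin (8.134) inputs as the TREE'S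
functionals `volumeDerivE`/`toroidalFluxDerivJ`/`toroidalCurrentJ`/`surfaceAverageE` of `Ψ = psiLC κ₀ g R_a q₀(g) (ε/R_a) =
NstxLike.psi` on the printed loop) OF THE EDGE SURFACE `r = ε/R_a` equals the certificate record `edgeData g (Vp/(2π))` of
`…NstxMercierEdgeGGJ` §7 (p482628), field by field, so that `SurfaceData.MercierCriterion` for every `g = F ≥ 1/4` holds for
the tree's own functionals — the «1-D reduction» stops being a MODELLED caveat.  No new enclosure: the substitution makes
each atomic `t`-integral an exact rational multiple of the kernel-enclosed `K₁…K₈`, `KX`, `KY` (p480149/p480967/p482340).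

THIS FILE: §2 the edge loop of the NSTX-like instance (`u = 4021/2500 + (39/25)cos t`, `u(θ) = U₊`, `u(π−θ) = U₋`,
`|∇Ψ|²·u = 4αρ²P(cos t)`, `w = κ₀/(2c√u)`, `∂w/∂r`, `c = 1/2 + 4d₃ = 1691292800/4215904879`); §3 continuity and
`T1: ∫₀^{2π} w = (κ₀/c)K₁`, `T2: ∫₀^{2π} ∂w/∂r = −(κ₀R_a/c)K₂`, `T3: ∫₀^π (u√u)⁻¹ = K₄`, `T4: ∫₀^π lcQKernelDr = −3R_aK₃`.
HONEST FRAMING (LADDER-GRIDFUSION three columns, never merged): CERTIFIED = kernel identities/inequalities about the MODEL's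
edge surface (ideal MHD, axisymmetric, Solov'ev profiles `μ₀p′ = −1`, `FF′ = 0`, analytic fixed-boundary PCF equilibrium
[cite: PatakiCerfonFreidberg2013, §6.1], free constant `F = RB_φ` a parameter); VALIDATED cross-checks live in
`pub/gridfusion/cert/F/mercier-dm-validated.md`; Mercier/GGJ is a NECESSARY (local interchange) criterion; nothing here says
any plasma or device is stable. No `native_decide`; no `decide` in this file (the enclosures are the imported Data files').
-/

noncomputable section

open Real MeasureTheory Set intervalIntegral
open Literature.Analysis.ValidatedNumerics Literature.Analysis.ValidatedNumerics.PolyMP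
open Literature.Analysis.ValidatedNumerics.ExpPoly (Poly)
open Literature.MathematicalPhysics.MHD Literature.MathematicalPhysics.MHD.Solovev
open Summit.Ventures.FusionMHD.Models.SolovevPCF

namespace Summit.Ventures.FusionMHD.Bench.SolovevPCFNstx.MercierEdge

open Summit.Ventures.FusionMHD.Bench.SolovevPCFIter.MercierEdge (theta theta_arg_sq theta_arg_lt_one cos_theta
  sin_sq_theta theta_zero theta_one continuous_theta hasDerivAt_theta integral_zero_pi_eq_theta integral_zero_two_pi_eq
  integral_zero_two_pi_eq_theta eval_const_two sqrt_two_sub_pos uIcc01)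

/-! ## §2 The printed edge loop of the NSTX-like instance in the substituted variable

Lee–Cerfon label of the plasma edge `Ψ = 0`: `r = a = ε/R_a` (`Models/SolovevPCFSafetyFactorProfile`), so
`rR_a = ε = 39/50`, `u(t) = R² = R_a² + 2εcos t = 4021/2500 + (39/25)cos t`; hence `u(θ(w)) = U₊(w)`,
`u(π − θ(w)) = U₋(w)` (the Qedge file's `Uplus/Uminus`), and `|∇Ψ|²·u = 4αρ²·P(cos t)` with `P₊/P₋` of Data1. -/

/-- The Lee–Cerfon amplitude `c = κ₀F/(2R_a³q₀(F)) = 1/2 + 4d₃` as the literal rational (NSTX-like). [folklore] -/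
theorem lcAmp_eq {g : ℝ} (hg : g ≠ 0) :
    NstxLike.kappa0 * g / (2 * NstxLike.Ra ^ 3 * NstxLike.q0 g) = (1691292800 / 4215904879 : ℝ) := by
  rw [NstxLike.lcAmplitude hg]; unfold NstxLike.d₃; norm_num

/-- `(ε/R_a)·R_a = ε = 39/50`. [folklore] -/
theorem edge_r_mul_Ra : NstxLike.ε / NstxLike.Ra * NstxLike.Ra = 39 / 50 := by
  rw [div_mul_cancel₀ _ NstxLike.Ra_pos.ne']; unfold NstxLike.ε; norm_num

/-- `u(t) = 4021/2500 + (39/25)cos t` on the edge loop. [folklore] -/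
theorem lcU_edge (t : ℝ) :
    lcU NstxLike.Ra (NstxLike.ε / NstxLike.Ra) t = 4021 / 2500 + 39 / 25 * Real.cos t := by
  unfold lcU
  rw [NstxLike.Ra_sq, show 2 * (NstxLike.ε / NstxLike.Ra) * NstxLike.Ra * Real.cos t
    = 2 * (NstxLike.ε / NstxLike.Ra * NstxLike.Ra) * Real.cos t by ring, edge_r_mul_Ra]
  ring

/-- `u` is even about `π`. [folklore] -/
theorem lcU_two_pi_sub (t : ℝ) :
    lcU NstxLike.Ra (NstxLike.ε / NstxLike.Ra) (2 * π - t) = lcU NstxLike.Ra (NstxLike.ε / NstxLike.Ra) t := by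
  rw [lcU_edge, lcU_edge, Real.cos_two_pi_sub]

/-- `u(θ(w)) = U₊(w)`. [folklore] -/
theorem lcU_theta {w : ℝ} (hw : w ∈ Icc (0 : ℝ) 1) :
    lcU NstxLike.Ra (NstxLike.ε / NstxLike.Ra) (theta w) = Uplus w := by
  rw [lcU_edge, cos_theta hw]; unfold Uplus; push_cast; ring

/-- `u(π − θ(w)) = U₋(w)`. [folklore] -/
theorem lcU_pi_sub_theta {w : ℝ} (hw : w ∈ Icc (0 : ℝ) 1) :
    lcU NstxLike.Ra (NstxLike.ε / NstxLike.Ra) (π - theta w) = Uminus w := by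
  rw [lcU_edge, Real.cos_pi_sub, cos_theta hw]; unfold Uminus; push_cast; ring

/-- `u > 0` on the edge loop. [folklore] -/
theorem lcU_edge_pos (t : ℝ) : 0 < lcU NstxLike.Ra (NstxLike.ε / NstxLike.Ra) t :=
  lcU_pos NstxLike.Ra_pos NstxLike.edge_minorRadius.1.le NstxLike.edge_minorRadius.2 t

/-- **`|∇Ψ|²·u = 4αρ²·P(cos t)` on the edge loop**, `P(s) = α(2su + ρ(1−s²))² + 4|d₃|u²(1−s²)` — the structure
behind Data1's `P₊/P₋` (`κ₀² = E = α/|d₃|`, `(2caR_a)² = c²ρ²`, `c = 4α`). [folklore] -/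
theorem lcGradSq_edge {g : ℝ} (hg : g ≠ 0) (t : ℝ) :
    lcGradSq NstxLike.kappa0 g NstxLike.Ra (NstxLike.q0 g) (NstxLike.ε / NstxLike.Ra) t
        * lcU NstxLike.Ra (NstxLike.ε / NstxLike.Ra) t
      = c4 * ((422823200/4215904879 : ℝ)
          * (2 * Real.cos t * lcU NstxLike.Ra (NstxLike.ε / NstxLike.Ra) t + (39/25 : ℝ) * (1 - Real.cos t ^ 2)) ^ 2
          + (833319279/8431809758 : ℝ) * lcU NstxLike.Ra (NstxLike.ε / NstxLike.Ra) t ^ 2 * (1 - Real.cos t ^ 2)) := by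
  have hu := lcU_edge_pos t
  unfold lcGradSq
  rw [show (2 * (NstxLike.kappa0 * g / (2 * NstxLike.Ra ^ 3 * NstxLike.q0 g)) * (NstxLike.ε / NstxLike.Ra)
      * NstxLike.Ra) = 2 * (NstxLike.kappa0 * g / (2 * NstxLike.Ra ^ 3 * NstxLike.q0 g))
      * (NstxLike.ε / NstxLike.Ra * NstxLike.Ra) by ring, lcAmp_eq hg,
    show NstxLike.ε / NstxLike.Ra * NstxLike.Ra * Real.sin t ^ 2
      = (NstxLike.ε / NstxLike.Ra * NstxLike.Ra) * Real.sin t ^ 2 by ring, edge_r_mul_Ra,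
    NstxLike.kappa0_sq, Real.sin_sq]
  unfold NstxLike.elongSq c4
  field_simp
  ring

/-- `|∇Ψ|²(θ(w)) = 4αρ²·P₊(w)/U₊(w)`. [folklore] -/
theorem lcGradSq_theta {g : ℝ} (hg : g ≠ 0) {w : ℝ} (hw : w ∈ Icc (0 : ℝ) 1) :
    lcGradSq NstxLike.kappa0 g NstxLike.Ra (NstxLike.q0 g) (NstxLike.ε / NstxLike.Ra) (theta w)
      = c4 * Pplus w / Uplus w := by
  have hu : 0 < Uplus w := Uplus_pos hw
  rw [eq_div_iff hu.ne', ← lcU_theta hw, lcGradSq_edge hg, lcU_theta hw, cos_theta hw, Pplus_eq]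
  unfold splus
  ring

/-- `|∇Ψ|²(π − θ(w)) = 4αρ²·P₋(w)/U₋(w)`. [folklore] -/
theorem lcGradSq_pi_sub_theta {g : ℝ} (hg : g ≠ 0) {w : ℝ} (hw : w ∈ Icc (0 : ℝ) 1) :
    lcGradSq NstxLike.kappa0 g NstxLike.Ra (NstxLike.q0 g) (NstxLike.ε / NstxLike.Ra) (π - theta w)
      = c4 * Pminus w / Uminus w := by
  have hu : 0 < Uminus w := Uminus_pos w
  rw [eq_div_iff hu.ne', ← lcU_pi_sub_theta hw, lcGradSq_edge hg, lcU_pi_sub_theta hw, Real.cos_pi_sub,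
    cos_theta hw, Pminus_eq]
  unfold sminus
  ring

/-- `|∇Ψ|²` is even about `π` on the edge loop. [folklore] -/
theorem lcGradSq_two_pi_sub {g : ℝ} (hg : g ≠ 0) (t : ℝ) :
    lcGradSq NstxLike.kappa0 g NstxLike.Ra (NstxLike.q0 g) (NstxLike.ε / NstxLike.Ra) (2 * π - t)
      = lcGradSq NstxLike.kappa0 g NstxLike.Ra (NstxLike.q0 g) (NstxLike.ε / NstxLike.Ra) t := by
  have hu := lcU_edge_pos t
  have h1 := lcGradSq_edge hg (2 * π - t)
  have h2 := lcGradSq_edge hg t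
  rw [lcU_two_pi_sub, Real.cos_two_pi_sub] at h1
  exact mul_right_cancel₀ hu.ne' (h1.trans h2.symm)

/-- The density `w(t) = κ₀/(2c√u)` on the edge loop. [folklore] -/
theorem lcAvgWeight_edge {g : ℝ} (hg : g ≠ 0) (t : ℝ) :
    lcAvgWeight NstxLike.kappa0 g NstxLike.Ra (NstxLike.q0 g) (NstxLike.ε / NstxLike.Ra) t
      = NstxLike.kappa0 / (2 * (1691292800 / 4215904879 : ℝ))
          * (Real.sqrt (lcU NstxLike.Ra (NstxLike.ε / NstxLike.Ra) t))⁻¹ := by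
  unfold lcAvgWeight
  rw [lcAmp_eq hg, div_eq_mul_inv, div_eq_mul_inv, mul_inv]
  ring

/-- `∂w/∂r(t) = −κ₀R_a cos t/(2c·u√u)` on the edge loop. [folklore] -/
theorem lcAvgWeightDr_edge {g : ℝ} (hg : g ≠ 0) (t : ℝ) :
    lcAvgWeightDr NstxLike.kappa0 g NstxLike.Ra (NstxLike.q0 g) (NstxLike.ε / NstxLike.Ra) t
      = -(NstxLike.kappa0 * NstxLike.Ra / (2 * (1691292800 / 4215904879 : ℝ)))
          * (Real.cos t * (lcU NstxLike.Ra (NstxLike.ε / NstxLike.Ra) t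
              * Real.sqrt (lcU NstxLike.Ra (NstxLike.ε / NstxLike.Ra) t))⁻¹) := by
  unfold lcAvgWeightDr
  rw [lcAmp_eq hg]
  ring


/-! ## §3 The nine atomic `t`-integrals of the GGJ input bridge as the certified `w`-integrals

Abbreviations in the docstrings: `κ₀, R_a, q₀(g), a = ε/R_a` the Lee–Cerfon parameters of the NSTX-like instance
(`NstxLike.psi_eq_psiLC`), `c = 1691292800/4215904879 = 1/2 + 4d₃`, `u, w, G` = `lcU, lcAvgWeight, lcGradSq` on the edge
loop, `K₁…K₈, KX, KY` the certified reals of `…MercierEdgeData1/2`, `…Averages` (`K₄ = edgeI`). -/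

section atomic

variable {g : ℝ} (hg : 0 < g)
include hg

/-- Positivity package on the edge loop (`u, G > 0`). [folklore] -/
theorem lcGradSq_edge_pos (t : ℝ) :
    0 < lcGradSq NstxLike.kappa0 g NstxLike.Ra (NstxLike.q0 g) (NstxLike.ε / NstxLike.Ra) t :=
  lcGradSq_pos NstxLike.Ra_pos NstxLike.kappa0_pos hg (NstxLike.q0_pos hg) NstxLike.edge_minorRadius.1
    NstxLike.edge_minorRadius.2 t

omit hg in
/-- Continuity of `u`. [folklore] -/
theorem continuous_lcU_edge : Continuous (lcU NstxLike.Ra (NstxLike.ε / NstxLike.Ra)) := by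
  unfold lcU; fun_prop

omit hg in
/-- Non-vanishing denominators on the edge loop (for `fun_prop`). [folklore] -/
theorem edge_denoms_ne (t : ℝ) :
    lcU NstxLike.Ra (NstxLike.ε / NstxLike.Ra) t ≠ 0
    ∧ lcU NstxLike.Ra (NstxLike.ε / NstxLike.Ra) t * Real.sqrt (lcU NstxLike.Ra (NstxLike.ε / NstxLike.Ra) t) ≠ 0
    ∧ lcU NstxLike.Ra (NstxLike.ε / NstxLike.Ra) t ^ 2 * Real.sqrt (lcU NstxLike.Ra (NstxLike.ε / NstxLike.Ra) t) ≠ 0 := by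
  have hu := lcU_edge_pos t
  have hs := Real.sqrt_pos.2 hu
  exact ⟨hu.ne', by positivity, by positivity⟩

/-- Continuity of `w`. [folklore] -/
theorem continuous_w_edge :
    Continuous (lcAvgWeight NstxLike.kappa0 g NstxLike.Ra (NstxLike.q0 g) (NstxLike.ε / NstxLike.Ra)) :=
  continuous_lcAvgWeight NstxLike.Ra_pos NstxLike.kappa0_pos hg (NstxLike.q0_pos hg)
    NstxLike.edge_minorRadius.1.le NstxLike.edge_minorRadius.2

omit hg in
/-- Continuity of `G = |∇Ψ|²` along the loop. [folklore] -/
theorem continuous_lcGradSq_edge :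
    Continuous (lcGradSq NstxLike.kappa0 g NstxLike.Ra (NstxLike.q0 g) (NstxLike.ε / NstxLike.Ra)) := by
  have hu : ∀ t, lcU NstxLike.Ra (NstxLike.ε / NstxLike.Ra) t ≠ 0 := fun t => (lcU_edge_pos t).ne'
  have cu := continuous_lcU_edge
  have e : lcGradSq NstxLike.kappa0 g NstxLike.Ra (NstxLike.q0 g) (NstxLike.ε / NstxLike.Ra)
      = fun t => (2 * (NstxLike.kappa0 * g / (2 * NstxLike.Ra ^ 3 * NstxLike.q0 g)) * (NstxLike.ε / NstxLike.Ra)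
          * NstxLike.Ra) ^ 2 * (lcU NstxLike.Ra (NstxLike.ε / NstxLike.Ra) t * Real.sin t ^ 2 / NstxLike.kappa0 ^ 2
          + (lcU NstxLike.Ra (NstxLike.ε / NstxLike.Ra) t * Real.cos t
              + NstxLike.ε / NstxLike.Ra * NstxLike.Ra * Real.sin t ^ 2) ^ 2
              / lcU NstxLike.Ra (NstxLike.ε / NstxLike.Ra) t) := by
    funext t; rfl
  rw [e]
  exact continuous_const.mul (((cu.mul (Real.continuous_sin.pow 2)).div_const _).add
    ((((cu.mul Real.continuous_cos).add (continuous_const.mul (Real.continuous_sin.pow 2))).pow 2).div cu hu))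

/-- `T1`: `∫₀^{2π} w dt = (κ₀/c)·K₁`. [folklore] -/
theorem integral_w_edge :
    ∫ t in (0 : ℝ)..(2 * π), lcAvgWeight NstxLike.kappa0 g NstxLike.Ra (NstxLike.q0 g) (NstxLike.ε / NstxLike.Ra) t
      = NstxLike.kappa0 / (1691292800 / 4215904879 : ℝ) * K1 := by
  have hg' := hg.ne'
  rw [integral_zero_two_pi_eq_theta _ (continuous_w_edge hg)
    (fun t => by rw [lcAvgWeight_edge hg', lcAvgWeight_edge hg', lcU_two_pi_sub])]
  have key : ∀ w ∈ uIcc (0:ℝ) 1,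
      (lcAvgWeight NstxLike.kappa0 g NstxLike.Ra (NstxLike.q0 g) (NstxLike.ε / NstxLike.Ra) (theta w)
        + lcAvgWeight NstxLike.kappa0 g NstxLike.Ra (NstxLike.q0 g) (NstxLike.ε / NstxLike.Ra) (π - theta w))
        * (2 / Real.sqrt (2 - w ^ 2))
      = NstxLike.kappa0 / (2 * (1691292800 / 4215904879 : ℝ)) * (K1e.toFun w * Poly.eval [2] w) := by
    intro w hw
    rw [uIcc01] at hw
    rw [lcAvgWeight_edge hg', lcAvgWeight_edge hg', lcU_theta hw, lcU_pi_sub_theta hw, toFun_K1e,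
      eval_const_two, div_eq_mul_inv 2]
    ring
  rw [integral_congr key, intervalIntegral.integral_const_mul]
  unfold K1
  ring

/-- `T2`: `∫₀^{2π} ∂w/∂r dt = −(κ₀R_a/c)·K₂`. [folklore] -/
theorem integral_wDr_edge :
    ∫ t in (0 : ℝ)..(2 * π), lcAvgWeightDr NstxLike.kappa0 g NstxLike.Ra (NstxLike.q0 g) (NstxLike.ε / NstxLike.Ra) t
      = -(NstxLike.kappa0 * NstxLike.Ra / (1691292800 / 4215904879 : ℝ)) * K2 := by
  have hg' := hg.ne'
  have hc : Continuous
      (lcAvgWeightDr NstxLike.kappa0 g NstxLike.Ra (NstxLike.q0 g) (NstxLike.ε / NstxLike.Ra)) := by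
    have e : lcAvgWeightDr NstxLike.kappa0 g NstxLike.Ra (NstxLike.q0 g) (NstxLike.ε / NstxLike.Ra)
        = fun t => -(NstxLike.kappa0 * NstxLike.Ra / (2 * (1691292800 / 4215904879 : ℝ)))
          * (Real.cos t * (lcU NstxLike.Ra (NstxLike.ε / NstxLike.Ra) t
              * Real.sqrt (lcU NstxLike.Ra (NstxLike.ε / NstxLike.Ra) t))⁻¹) := by
      funext t; exact lcAvgWeightDr_edge hg' t
    rw [e]
    have hden : ∀ t, lcU NstxLike.Ra (NstxLike.ε / NstxLike.Ra) t
        * Real.sqrt (lcU NstxLike.Ra (NstxLike.ε / NstxLike.Ra) t) ≠ 0 := fun t => (edge_denoms_ne t).2.1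
    have cu : Continuous (lcU NstxLike.Ra (NstxLike.ε / NstxLike.Ra)) := continuous_lcU_edge
    exact continuous_const.mul (Real.continuous_cos.mul ((cu.mul cu.sqrt).fun_inv₀ hden))
  rw [integral_zero_two_pi_eq_theta _ hc
    (fun t => by rw [lcAvgWeightDr_edge hg', lcAvgWeightDr_edge hg', lcU_two_pi_sub, Real.cos_two_pi_sub])]
  have key : ∀ w ∈ uIcc (0:ℝ) 1,
      (lcAvgWeightDr NstxLike.kappa0 g NstxLike.Ra (NstxLike.q0 g) (NstxLike.ε / NstxLike.Ra) (theta w)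
        + lcAvgWeightDr NstxLike.kappa0 g NstxLike.Ra (NstxLike.q0 g) (NstxLike.ε / NstxLike.Ra) (π - theta w))
        * (2 / Real.sqrt (2 - w ^ 2))
      = -(NstxLike.kappa0 * NstxLike.Ra / (2 * (1691292800 / 4215904879 : ℝ)))
          * (K2e.toFun w * Poly.eval [2] w) := by
    intro w hw
    rw [uIcc01] at hw
    rw [lcAvgWeightDr_edge hg', lcAvgWeightDr_edge hg', lcU_theta hw, lcU_pi_sub_theta hw, Real.cos_pi_sub,
      cos_theta hw, toFun_K2e, eval_const_two, div_eq_mul_inv 2]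
    unfold splus sminus
    ring
  rw [integral_congr key, intervalIntegral.integral_const_mul]
  unfold K2
  ring

omit hg in
/-- `T3`: `∫₀^π (u√u)⁻¹ dt = K₄ = edgeI`. [folklore] -/
theorem integral_qKernel_edge :
    ∫ t in (0 : ℝ)..π, (lcU NstxLike.Ra (NstxLike.ε / NstxLike.Ra) t
        * Real.sqrt (lcU NstxLike.Ra (NstxLike.ε / NstxLike.Ra) t))⁻¹ = K4 := by
  have cu : Continuous (lcU NstxLike.Ra (NstxLike.ε / NstxLike.Ra)) := continuous_lcU_edge
  have hden : ∀ t, lcU NstxLike.Ra (NstxLike.ε / NstxLike.Ra) t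
      * Real.sqrt (lcU NstxLike.Ra (NstxLike.ε / NstxLike.Ra) t) ≠ 0 := fun t => (edge_denoms_ne t).2.1
  have hc : Continuous fun t => (lcU NstxLike.Ra (NstxLike.ε / NstxLike.Ra) t
      * Real.sqrt (lcU NstxLike.Ra (NstxLike.ε / NstxLike.Ra) t))⁻¹ := (cu.mul cu.sqrt).fun_inv₀ hden
  rw [integral_zero_pi_eq_theta _ hc]
  have key : ∀ w ∈ uIcc (0:ℝ) 1,
      ((lcU NstxLike.Ra (NstxLike.ε / NstxLike.Ra) (theta w)
          * Real.sqrt (lcU NstxLike.Ra (NstxLike.ε / NstxLike.Ra) (theta w)))⁻¹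
        + (lcU NstxLike.Ra (NstxLike.ε / NstxLike.Ra) (π - theta w)
          * Real.sqrt (lcU NstxLike.Ra (NstxLike.ε / NstxLike.Ra) (π - theta w)))⁻¹)
        * (2 / Real.sqrt (2 - w ^ 2))
      = edgeIntegrand.toFun w * Poly.eval [2] w := by
    intro w hw
    rw [uIcc01] at hw
    rw [lcU_theta hw, lcU_pi_sub_theta hw, toFun_edgeIntegrand, eval_const_two, div_eq_mul_inv 2, mul_inv, mul_inv]
    ring
  rw [integral_congr key]
  rfl

omit hg in
/-- `T4`: `∫₀^π lcQKernelDr dt = −3R_a·K₃`. [folklore] -/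
theorem integral_qKernelDr_edge :
    ∫ t in (0 : ℝ)..π, lcQKernelDr NstxLike.Ra (NstxLike.ε / NstxLike.Ra) t = -(3 * NstxLike.Ra) * K3 := by
  have cu : Continuous (lcU NstxLike.Ra (NstxLike.ε / NstxLike.Ra)) := continuous_lcU_edge
  have hc : Continuous (lcQKernelDr NstxLike.Ra (NstxLike.ε / NstxLike.Ra)) := by
    have e : lcQKernelDr NstxLike.Ra (NstxLike.ε / NstxLike.Ra) = fun t => -(3 * (NstxLike.Ra * Real.cos t))
        / (lcU NstxLike.Ra (NstxLike.ε / NstxLike.Ra) t ^ 2 * Real.sqrt (lcU NstxLike.Ra (NstxLike.ε / NstxLike.Ra) t)) := by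
      funext t; rfl
    rw [e]
    have hden : ∀ t, lcU NstxLike.Ra (NstxLike.ε / NstxLike.Ra) t ^ 2
        * Real.sqrt (lcU NstxLike.Ra (NstxLike.ε / NstxLike.Ra) t) ≠ 0 := fun t => (edge_denoms_ne t).2.2
    fun_prop (disch := assumption)
  rw [integral_zero_pi_eq_theta _ hc]
  have key : ∀ w ∈ uIcc (0:ℝ) 1,
      (lcQKernelDr NstxLike.Ra (NstxLike.ε / NstxLike.Ra) (theta w)
        + lcQKernelDr NstxLike.Ra (NstxLike.ε / NstxLike.Ra) (π - theta w)) * (2 / Real.sqrt (2 - w ^ 2))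
      = -(3 * NstxLike.Ra) * (K3e.toFun w * Poly.eval [2] w) := by
    intro w hw
    rw [uIcc01] at hw
    unfold lcQKernelDr
    rw [lcU_theta hw, lcU_pi_sub_theta hw, Real.cos_pi_sub, cos_theta hw, toFun_K3e, eval_const_two,
      div_eq_mul_inv 2]
    have h1 : Uplus w ≠ 0 := (Uplus_pos hw).ne'
    have h2 : Uminus w ≠ 0 := (Uminus_pos w).ne'
    have h3 : Real.sqrt (Uplus w) ≠ 0 := (Real.sqrt_pos.2 (Uplus_pos hw)).ne'
    have h4 : Real.sqrt (Uminus w) ≠ 0 := (Real.sqrt_pos.2 (Uminus_pos w)).ne'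
    have h5 : Real.sqrt (2 - w ^ 2) ≠ 0 := (sqrt_two_sub_pos hw).ne'
    unfold splus sminus
    field_simp
    ring
  rw [integral_congr key, intervalIntegral.integral_const_mul]
  unfold K3
  ring

end atomic

end Summit.Ventures.FusionMHD.Bench.SolovevPCFNstx.MercierEdge

end
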